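import Literature.Algebra.EuclideanLattices.SmoothingUniformity
import HarnessLib

/-!
# A discrete Gaussian on a lattice coset plus a continuous Gaussian is a wider continuous Gaussian (Regev 2009, Claim 3.9 = BLPRS 2013, Lemma 2.8), density form

Topic `Algebra/EuclideanLattices` (family `pqc`). Bottom layer of the decomposition of
Brakerski–Langlois–Peikert–Regev–Stehlé 2013 (`blprs_gapSVP_sqrt_dim_to_lwe_classical`, pqc.S21;
their Lemma 2.8) and of Regev's reduction (pqc.S19/S20: this is the lemma that lets the reduction
turn a discrete Gaussian sample of a lattice coset into an LWE sample with genuinely Gaussian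
noise). Everything here is PROVED; theorems only.

## Results (`L` a full-rank lattice in dimension `n`, `u, y ∈ E`, `0 < r, s`, `t = √(r² + s²)`)

* `gaussianFunction_sub_neg_mul_gaussianFunction_sub_add` — the product identity behind every
  "Gaussian plus Gaussian" lemma: `ρ_r(v) ρ_s(y - v) = ρ_t(y) ρ_{rs/t}(v - (r²/t²) y)`
  (completing the square), written for `v = x + u`.
* `Regev2009.abs_convDensity_sub_le` — **Regev 2009, Claim 3.9 (J. ACM; Lemma 3.9 of the STOC 2005
  version), pointwise density form = BLPRS 2013, Lemma 2.8**: assume `rs/t ≥ η_ε(L)` with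
  `0 < ε ≤ 1/2`, and let `Y` be the law of `v + e` with `v ← D_{L+u,r}` and `e ← D_s`; its density is
  `Y(y) = s⁻ⁿ ∑_{x ∈ L} D_{L,r,-u}(x) ρ_s(y - (x + u))` and
  `|Y(y) - ρ_t(y)/tⁿ| ≤ 4ε · ρ_t(y)/tⁿ` for EVERY `y` (Regev, proof of Claim 3.9:
  "`|Y(x) − ρ_t(x)/tⁿ| ≤ ρ_t(x)/tⁿ · 4ε`").
* `Regev2009.abs_setIntegral_convDensity_sub_le` — **the printed statement, event form**: for every
  measurable event `A`, `|Y(A) - D_t(A)| = |∫_A Y - ∫_A ρ_t/tⁿ| ≤ 4ε`, i.e. `Δ(Y, D_t) ≤ 4ε`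
  (densities w.r.t. the canonical volume of `E`, as in `SmoothingUniformity.lean`; packaging `Y` as
  the push-forward measure of `D_{L+u,r} ⊗ D_s` under `+` is left to consumers).

## Proof (as printed, Regev 2009 §3.3)

`∑_x ρ_r(x + u) ρ_s(y - x - u) = ρ_t(y) ρ_{rs/t, c}(L)` with `c = (r/t)² y - u` by the product identity,
so `Y(y) = ρ_t(y)/sⁿ · ρ_{rs/t,c}(L)/ρ_{r,-u}(L)`; by Regev's Claim 3.8
(`abs_gaussianMass_div_sub_one_le_holds`, as `r ≥ rs/t ≥ η_ε(L)`) the two masses are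
`(rs/t)ⁿ/vol · [1 ± ε]` and `rⁿ/vol · [1 ± ε]`, whence `Y(y) = ρ_t(y)/tⁿ · a/b` with
`a, b ∈ [1-ε, 1+ε]`, and `|a/b - 1| ≤ 4ε` for `ε ≤ 1/2`.

## References

* O. Regev, *On lattices, learning with errors, random linear codes, and cryptography*, J. ACM 56
  (2009), Claim 3.9 and its proof (STOC 2005 version: Lemma 3.9, pp. 20–21,
  `lit read doi:10.1145/1060590.1060603`).
* Z. Brakerski, A. Langlois, C. Peikert, O. Regev, D. Stehlé, *Classical hardness of learning with
  errors*, STOC 2013, Lemma 2.8 (arXiv:1306.0281).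
-/

noncomputable section

open MeasureTheory Module
open scoped Real ENNReal InnerProductSpace

namespace Literature.Algebra.EuclideanLattices

variable {E : Type*} [NormedAddCommGroup E] [InnerProductSpace ℝ E]

/-! ### The product identity -/

/-- **Product of two Gaussians, completing the square**: for `0 < r, s`, `t = √(r² + s²)` and all
`v, y`, `ρ_r(v) ρ_s(y - v) = ρ_t(y) · ρ_{rs/t}(v - (r²/t²) y)`; here with `v = x - (-u)` as it
occurs for the coset Gaussian `D_{L+u,r} = u + D_{L,r,-u}`. (The exponents agree because
`‖v‖²/r² + ‖y-v‖²/s² - ‖y‖²/t² - ‖v - (r²/t²)y‖² t²/(r²s²) = (r² + s² - t²)(…) = 0`.) [folklore] -/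
theorem gaussianFunction_sub_neg_mul_gaussianFunction_sub_add {r s : ℝ} (hr : 0 < r) (hs : 0 < s)
    (x u y : E) :
    gaussianFunction r (x - -u) * gaussianFunction s (y - (x + u)) =
      gaussianFunction (Real.sqrt (r ^ 2 + s ^ 2)) y *
        gaussianFunction (r * s / Real.sqrt (r ^ 2 + s ^ 2))
          (x - ((r ^ 2 / Real.sqrt (r ^ 2 + s ^ 2) ^ 2) • y - u)) := by
  set t := Real.sqrt (r ^ 2 + s ^ 2) with ht
  have htsq : t ^ 2 = r ^ 2 + s ^ 2 := Real.sq_sqrt (by positivity)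
  have ht0 : 0 < t := Real.sqrt_pos.2 (by positivity)
  set v : E := x + u with hv
  have hxv : x - -u = v := by rw [hv, sub_neg_eq_add]
  have hxv' : x - ((r ^ 2 / t ^ 2) • y - u) = v - (r ^ 2 / t ^ 2) • y := by
    rw [hv]; abel
  rw [hxv, hxv']
  simp only [gaussianFunction, ← Real.exp_add]
  congr 1
  have h1 : ‖y - v‖ ^ 2 = ‖y‖ ^ 2 - 2 * ⟪y, v⟫_ℝ + ‖v‖ ^ 2 := norm_sub_sq_real y v
  have h2 : ‖v - (r ^ 2 / t ^ 2) • y‖ ^ 2 =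
      ‖v‖ ^ 2 - 2 * ((r ^ 2 / t ^ 2) * ⟪y, v⟫_ℝ) + (r ^ 2 / t ^ 2) ^ 2 * ‖y‖ ^ 2 := by
    rw [norm_sub_sq_real, inner_smul_right, real_inner_comm, norm_smul, mul_pow, Real.norm_eq_abs,
      sq_abs]
  rw [h1, h2, show (r * s / t) ^ 2 = r ^ 2 * s ^ 2 / t ^ 2 by rw [div_pow, mul_pow], htsq]
  have hr2 : r ^ 2 ≠ 0 := by positivity
  have hs2 : s ^ 2 ≠ 0 := by positivity
  have hrs : r ^ 2 + s ^ 2 ≠ 0 := by positivity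
  field_simp
  ring

/-! ### Regev's Claim 3.9 -/

variable [FiniteDimensional ℝ E] [MeasurableSpace E] [BorelSpace E]
variable (L : Submodule ℤ E) [DiscreteTopology L] [IsZLattice ℝ L]

/-- For `0 ≤ 1 - ε`-type bookkeeping: if `|a - 1| ≤ ε`, `|b - 1| ≤ ε` and `0 < ε ≤ 1/2`, then
`|a/b - 1| ≤ 4ε` (Regev 2009, proof of Claim 3.9: "`(1-ε)/(1+ε) ≥ 1 - 2ε` and
`(1+ε)/(1-ε) ≤ 1 + 4ε`"). [cite: RegevLWE2009, Claim 3.9 (proof)] -/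
theorem abs_div_sub_one_le_four_mul {a b ε : ℝ} (hε : 0 < ε) (hε' : ε ≤ 1 / 2)
    (ha : |a - 1| ≤ ε) (hb : |b - 1| ≤ ε) : |a / b - 1| ≤ 4 * ε := by
  obtain ⟨ha1, ha2⟩ := abs_le.1 ha
  obtain ⟨hb1, hb2⟩ := abs_le.1 hb
  have hb0 : 0 < b := by linarith
  rw [abs_le]
  constructor
  · -- lower bound: `(1 - 4ε) b ≤ a`
    have h : (1 - 4 * ε) * b ≤ a := by
      rcases le_or_gt 0 (1 - 4 * ε) with h4 | h4
      · nlinarith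
      · nlinarith
    have : 1 - 4 * ε ≤ a / b := by rwa [le_div_iff₀ hb0]
    linarith
  · -- upper bound: `a ≤ (1 + 4ε) b`
    have h : a ≤ (1 + 4 * ε) * b := by nlinarith
    have : a / b ≤ 1 + 4 * ε := by rwa [div_le_iff₀ hb0]
    linarith

/-- **Regev 2009, Claim 3.9 (pointwise density form) = BLPRS 2013, Lemma 2.8.** Let `L` be a
full-rank lattice in dimension `n`, `u ∈ E`, `0 < r, s`, `t = √(r² + s²)`, and assume
`rs/t ≥ η_ε(L)` for some `0 < ε ≤ 1/2` (Regev: `ε < 1/2`). Let `Y` be the distribution of `v + e`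
where `v ← D_{L+u,r}` (the discrete Gaussian on the coset `L + u`, i.e. `x + u` with
`x ← discreteGaussian L r (-u)`) and `e ← D_s` (density `ρ_s/sⁿ`), so that `Y` has density
`Y(y) = s⁻ⁿ ∑_{x ∈ L} D_{L,r,-u}(x) ρ_s(y - (x + u))`. Then for every `y`,
`|Y(y) - ρ_t(y)/tⁿ| ≤ 4ε · ρ_t(y)/tⁿ` — the estimate Regev proves ("this implies that the
statistical distance between `Y` and `D_t` is at most `4ε`"). [cite: RegevLWE2009, Claim 3.9] -/
theorem Regev2009.abs_convDensity_sub_le (u y : E) {ε r s : ℝ} (hε : 0 < ε) (hε' : ε ≤ 1 / 2)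
    (hr : 0 < r) (hs : 0 < s)
    (hη : smoothingParameter L ε ≤ r * s / Real.sqrt (r ^ 2 + s ^ 2)) :
    |(∑' x : L, (discreteGaussian L r (-u) x).toReal * gaussianFunction s (y - ((x : E) + u))) /
          s ^ finrank ℝ E -
        gaussianFunction (Real.sqrt (r ^ 2 + s ^ 2)) y / Real.sqrt (r ^ 2 + s ^ 2) ^ finrank ℝ E| ≤
      4 * ε * (gaussianFunction (Real.sqrt (r ^ 2 + s ^ 2)) y /
        Real.sqrt (r ^ 2 + s ^ 2) ^ finrank ℝ E) := by
  set n : ℕ := finrank ℝ E with hn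
  set t := Real.sqrt (r ^ 2 + s ^ 2) with ht
  have htsq : t ^ 2 = r ^ 2 + s ^ 2 := Real.sq_sqrt (by positivity)
  have ht0 : 0 < t := Real.sqrt_pos.2 (by positivity)
  set σ := r * s / t with hσdef
  have hσ0 : 0 < σ := by positivity
  have hst : s ≤ t := by
    rw [ht, Real.le_sqrt hs.le] <;> nlinarith [sq_nonneg r, sq_nonneg s]
  have hσr : σ ≤ r := by
    rw [hσdef, div_le_iff₀ ht0]
    nlinarith
  have hηr : smoothingParameter L ε ≤ r := hη.trans hσr
  -- the two lattice masses and Claim 3.8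
  set c : E := (r ^ 2 / t ^ 2) • y - u with hc
  set Mσ : ℝ := (gaussianMass σ c (L : Set E)).toReal with hMσ
  set Mr : ℝ := (gaussianMass r (-u) (L : Set E)).toReal with hMr
  have h38σ : |Mσ / (σ ^ n / ZLattice.covolume L) - 1| ≤ ε :=
    abs_gaussianMass_div_sub_one_le_holds L hε hσ0 hη c
  have h38r : |Mr / (r ^ n / ZLattice.covolume L) - 1| ≤ ε :=
    abs_gaussianMass_div_sub_one_le_holds L hε hr hηr (-u)
  have hcov : 0 < ZLattice.covolume L := ZLattice.covolume_pos L volume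
  have hMσ' : Mσ = ∑' x : L, gaussianFunction σ ((x : E) - c) := by
    rw [hMσ, gaussianMass_coe_eq_ofReal_tsum L hσ0.ne' c,
      ENNReal.toReal_ofReal (tsum_nonneg fun _ => (gaussianFunction_pos _ _).le)]
  have hMr' : Mr = ∑' x : L, gaussianFunction r ((x : E) - -u) := by
    rw [hMr, gaussianMass_coe_eq_ofReal_tsum L hr.ne' (-u),
      ENNReal.toReal_ofReal (tsum_nonneg fun _ => (gaussianFunction_pos _ _).le)]
  have hMr0 : 0 < Mr := by
    rw [hMr']
    exact tsum_gaussianFunction_sub_pos L hr.ne' (-u)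
  -- the discrete Gaussian weights `D_{L,r,-u}(x) = ρ_r(x + u)/Mr`
  have hD : ∀ x : L, (discreteGaussian L r (-u) x).toReal = gaussianFunction r ((x : E) - -u) / Mr := by
    intro x
    rw [discreteGaussian_apply L hr (-u) x, ENNReal.toReal_mul,
      ENNReal.toReal_ofReal (gaussianFunction_pos _ _).le, ENNReal.toReal_inv, hMr, div_eq_mul_inv]
  -- the numerator: `∑_x D(x) ρ_s(y - x - u) = ρ_t(y) Mσ / Mr`
  have hN : ∑' x : L, (discreteGaussian L r (-u) x).toReal * gaussianFunction s (y - ((x : E) + u)) =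
      gaussianFunction t y * Mσ / Mr := by
    have hterm : ∀ x : L,
        (discreteGaussian L r (-u) x).toReal * gaussianFunction s (y - ((x : E) + u)) =
          gaussianFunction t y * gaussianFunction σ ((x : E) - c) / Mr := by
      intro x
      rw [hD, div_mul_eq_mul_div,
        gaussianFunction_sub_neg_mul_gaussianFunction_sub_add hr hs (x : E) u y]
    rw [tsum_congr hterm, tsum_div_const, tsum_mul_left, ← hMσ']
  rw [hN]
  -- rewrite everything as `g * (a/b - 1)` with `g = ρ_t(y)/tⁿ`, `a = Mσ/(σⁿ/vol)`, `b = Mr/(rⁿ/vol)`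
  set g : ℝ := gaussianFunction t y / t ^ n with hg
  have hg0 : 0 < g := div_pos (gaussianFunction_pos _ _) (pow_pos ht0 n)
  set a : ℝ := Mσ / (σ ^ n / ZLattice.covolume L) with ha
  set b : ℝ := Mr / (r ^ n / ZLattice.covolume L) with hb
  have hb0 : 0 < b := div_pos hMr0 (div_pos (pow_pos hr n) hcov)
  have hσn : σ ^ n = r ^ n * s ^ n / t ^ n := by
    rw [hσdef, div_pow, mul_pow]
  have hkey : gaussianFunction t y * Mσ / Mr / s ^ n = g * (a / b) := by
    rw [hg, ha, hb, hσn]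
    have hrn : r ^ n ≠ 0 := pow_ne_zero _ hr.ne'
    have hsn : s ^ n ≠ 0 := pow_ne_zero _ hs.ne'
    have htn : t ^ n ≠ 0 := pow_ne_zero _ ht0.ne'
    have hMrne : Mr ≠ 0 := hMr0.ne'
    have hcovne : ZLattice.covolume L ≠ 0 := hcov.ne'
    field_simp
  rw [hkey, show g * (a / b) - g = g * (a / b - 1) by ring, abs_mul, abs_of_pos hg0,
    mul_comm (4 * ε) g]
  exact mul_le_mul_of_nonneg_left (abs_div_sub_one_le_four_mul hε hε' h38σ h38r) hg0.le

/-- Measurability of the convolution density `y ↦ s⁻ⁿ ∑_{x ∈ L} D_{L,r,-u}(x) ρ_s(y - (x + u))`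
(a countable sum of continuous functions). [folklore] -/
theorem Regev2009.measurable_convDensity (u : E) (r s : ℝ) :
    Measurable fun y : E =>
      (∑' x : L, (discreteGaussian L r (-u) x).toReal * gaussianFunction s (y - ((x : E) + u))) /
        s ^ finrank ℝ E := by
  refine (Measurable.tsum fun x => ?_).div_const _
  refine measurable_const.mul (Continuous.measurable ?_)
  unfold gaussianFunction
  fun_prop

/-- **Regev 2009, Claim 3.9, as printed (event form) = BLPRS 2013, Lemma 2.8**: under the hypotheses
of `Regev2009.abs_convDensity_sub_le`, the law `Y` of `v + e` (`v ← D_{L+u,r}`, `e ← D_s`; density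
`Y(y) = s⁻ⁿ ∑_{x ∈ L} D_{L,r,-u}(x) ρ_s(y - (x + u))` w.r.t. the volume of `E`) and the continuous
Gaussian `D_t`, `t = √(r² + s²)` (density `ρ_t/tⁿ`) give every measurable event `A` probabilities
that differ by at most `4ε`: `|Y(A) - D_t(A)| ≤ 4ε`; i.e. the statistical distance between `Y` and
`D_t` is at most `4ε`. Proof: integrate the pointwise bound, `∫_A |Y - ρ_t/tⁿ| ≤ 4ε ∫_A ρ_t/tⁿ ≤ 4ε`.
[cite: RegevLWE2009, Claim 3.9] -/
theorem Regev2009.abs_setIntegral_convDensity_sub_le (u : E) {ε r s : ℝ} (hε : 0 < ε)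
    (hε' : ε ≤ 1 / 2) (hr : 0 < r) (hs : 0 < s)
    (hη : smoothingParameter L ε ≤ r * s / Real.sqrt (r ^ 2 + s ^ 2)) (A : Set E) :
    |(∫ y in A, (∑' x : L, (discreteGaussian L r (-u) x).toReal *
          gaussianFunction s (y - ((x : E) + u))) / s ^ finrank ℝ E) -
        ∫ y in A, gaussianFunction (Real.sqrt (r ^ 2 + s ^ 2)) y /
          Real.sqrt (r ^ 2 + s ^ 2) ^ finrank ℝ E| ≤ 4 * ε := by
  set n : ℕ := finrank ℝ E with hn
  set t := Real.sqrt (r ^ 2 + s ^ 2) with ht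
  have ht0 : 0 < t := Real.sqrt_pos.2 (by positivity)
  set Y : E → ℝ := fun y =>
    (∑' x : L, (discreteGaussian L r (-u) x).toReal * gaussianFunction s (y - ((x : E) + u))) / s ^ n
    with hY
  set g : E → ℝ := fun y => gaussianFunction t y / t ^ n with hg
  have hpt : ∀ y, |Y y - g y| ≤ 4 * ε * g y := fun y =>
    Regev2009.abs_convDensity_sub_le L u y hε hε' hr hs hη
  have hg0 : ∀ y, 0 ≤ g y := fun y => div_nonneg (gaussianFunction_pos _ _).le (pow_nonneg ht0.le _)
  have hg_int : Integrable g := by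
    have h := (integrable_gaussianFunction_sub ht0 (0 : E)).div_const (t ^ n)
    refine h.congr (Filter.Eventually.of_forall fun y => ?_)
    simp [hg, sub_zero]
  have hg_one : ∫ y, g y = 1 := by
    have h := integral_gaussianFunction_sub ht0 (0 : E)
    simp only [sub_zero] at h
    simp only [hg]
    rw [integral_div, h, div_self (pow_ne_zero _ ht0.ne')]
  have hY_meas : Measurable Y := Regev2009.measurable_convDensity L u r s
  -- `Y` is dominated by `(1 + 4ε) g`, hence integrable
  have hY_int : Integrable Y := by
    refine Integrable.mono' (hg_int.const_mul (1 + 4 * ε)) hY_meas.aestronglyMeasurable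
      (Filter.Eventually.of_forall fun y => ?_)
    have h1 := hpt y
    have h2 : |Y y| ≤ |Y y - g y| + |g y| := by
      have := abs_add_le (Y y - g y) (g y)
      rwa [sub_add_cancel] at this
    rw [Real.norm_eq_abs, abs_of_nonneg (hg0 y)] at *
    nlinarith [hg0 y]
  -- integrate the pointwise bound over `A`
  have hdiff : (∫ y in A, Y y) - ∫ y in A, g y = ∫ y in A, (Y y - g y) :=
    (integral_sub hY_int.integrableOn hg_int.integrableOn).symm
  show |(∫ y in A, Y y) - ∫ y in A, g y| ≤ 4 * ε
  rw [hdiff]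
  calc |∫ y in A, (Y y - g y)| ≤ ∫ y in A, |Y y - g y| := abs_integral_le_integral_abs
    _ ≤ ∫ y in A, 4 * ε * g y :=
        integral_mono_of_nonneg (Filter.Eventually.of_forall fun y => abs_nonneg _)
          ((hg_int.const_mul (4 * ε)).integrableOn) (Filter.Eventually.of_forall hpt)
    _ = 4 * ε * ∫ y in A, g y := integral_const_mul _ _
    _ ≤ 4 * ε * ∫ y, g y := by
        refine mul_le_mul_of_nonneg_left ?_ (by positivity)
        exact setIntegral_le_integral hg_int (Filter.Eventually.of_forall hg0)
    _ = 4 * ε := by rw [hg_one, mul_one]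

end Literature.Algebra.EuclideanLattices

end
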